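import Mathlib.Algebra.Field.ZMod
import Summits.MatrixMultiplication.OmegaCensus.RingMetaCyclic

/-!
# ω-census, family (b3): conjecture C9 (b) — the TWO-GENERATOR BOX: `R ⋊_u ℤ/n` is box-useless whenever `x` and `u·x` are `𝔽_p`-independent

HONEST FRAMING (pub-omega census; verbatim): lottery ticket; floor = certified bounds/negative ranges.
Census BOOKKEEPING (conjecture C9 of the cell, STRUCTURE.md §2, `BoxRatioSectionLaw`; pub-omega stpp-1 gen 23, the atom lane:
Schmidt atoms `A(p,q) = 𝔽_{p^k} ⋊ μ_q` with `k = ord_q p ≥ 2`, ALL `q` at once).  Nothing here is progress on `ω`.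

THE CONSTRUCTION.  `R` a finite commutative ring, `u ∈ R` with `u ^ n = 1`, `x ∈ R`, and an additive `λ₀ : R → 𝔽_p` (`p` prime)
with `λ₀ (u x) = 0 ≠ λ₀ x` (equivalently: `x, u x` are `𝔽_p`-linearly independent).  Box (`RingMetaCyclic.RBox`):
`Y = {1, a^x, a^{2x}}`, `W = {1, a^{3x}, b}` — `b`-exponents `{0, 1}` only, so the `72` forbidden differences `dd c c'` lie in
`ℤx + ℤ·ux` and `λ (dd c c') = h(c,c') · λ x` for the fixed integers `h(c,c') = (M_{i'} − M_i − N_j)·B_{j'} + N_{j'}·B_j`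
(`M = (0,1,2)`, `N = (0,3,0)`, `B = (1,1,0)`), independently of `R`, `u`, `n`.  Pattern `T = {(c, r) : λ r ∈ A_c}` for
`λ = t·(λ₀ x)⁻¹·λ₀`; the nine sets `A_c ⊆ 𝔽_p` are INTERVALS of residues: for `p = 6L + 5` (`t = L + 1 = 6⁻¹`):
`A_(0,0) = [1, L]`, the other five `b⁰`-columns `[0, L]`, `A_(0,2) = [3L+3, p−1]`, `A_(1,2) = [2L+2, 3L+2]`, `A_(2,2) = [L+1, 2L+1]`,
total `11L + 9 ≥ (9/5)p`; for `p = 6L + 1`, `L ≥ 4` (`t = −L = 6⁻¹`): the six `b⁰`-columns `[0, L−1]`, `A_(0,2) = [L, 3L−1]`,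
`A_(1,2) = [3L, 5L−1]`, `A_(2,2) = [5L, 6L]`, total `11L + 1 ≥ (9/5)p`.  For `p ∈ {7, 13, 19}` NO two-generator box works (the
family's supremum density is `11/6`: the six `b⁰`-columns tile `𝔽_p` at most once and each avoids a full translate of the three
`b¹`-columns; `⌊11p/6⌋ < ⌈9p/5⌉` exactly for `p ∈ {7, 13, 19}` among the primes `≥ 5`) — those, and `p = 2, 3`, need three
generators (separate file).
THIS FILE (part 1 of 2): `RCyc.RBox.lamPattern` / `lamPattern_indep` / `card_lamPattern_mul` / `not_boxUseful_of_lamPattern`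
(generic pull-back of a one-dimensional pattern along a surjective additive map), residue intervals `TwoGen.Ival` with
`card_Ival` and the separation tool `val_cases_of_sub_eq`, the box `TwoGen.box` with its coefficient law `TwoGen.lam_dd` and
nondegeneracy `TwoGen.box_nondeg`.  Part 2 (`TwoGenBoxMain`): the intervals, the separation, and `TwoGen.not_boxUseful`.
-/

namespace Summit.MatrixMultiplication.OmegaCensus

open Finset ProductBoxBound

/-! ### Pulling a one-dimensional pattern back along an additive map -/

namespace RCyc.RBox

variable {R : Type*} [CommRing R] [Fintype R] [DecidableEq R] {q : ℕ} {u : R} (D : RBox R q)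
variable {P : Type*} [AddCommGroup P] [Fintype P] [DecidableEq P]

/-- The pattern pulled back along `lam : R →+ P` from column sets `A c ⊆ P`: over column `c`, every `r` with `lam r ∈ A c`.
[folklore] -/
def lamPattern (lam : R →+ P) (A : Fin 3 × Fin 3 → Finset P) : Finset ((Fin 3 × Fin 3) × R) :=
  univ.filter fun x => lam x.2 ∈ A x.1

omit [Fintype P] [DecidableEq R] in
/-- If `lam (dd c c') = δ c c'` and the column sets avoid the differences `δ c c'` (`c ≠ c'`), the pulled-back pattern is
independent. [folklore] -/
theorem lamPattern_indep [NeZero q] [Fact (u ^ q = 1)] (lam : R →+ P) (A : Fin 3 × Fin 3 → Finset P)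
    (δ : Fin 3 × Fin 3 → Fin 3 × Fin 3 → P) (hδ : ∀ c c', c ≠ c' → lam (D.dd u c c') = δ c c')
    (hA : ∀ c c', c ≠ c' → ∀ z ∈ A c, ∀ z' ∈ A c', z - z' ≠ δ c c') :
    D.PatIndep u (lamPattern lam A) := by
  intro x hx y hy hxy h
  rw [lamPattern, mem_filter] at hx hy
  by_cases hc : x.1 = y.1
  · apply hxy
    have h0 : D.dd u x.1 x.1 = 0 := by simp only [dd]; ring
    rw [← hc, h0, sub_eq_zero] at h
    exact Prod.ext hc h
  · have := congrArg lam h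
    rw [map_sub, hδ _ _ hc] at this
    exact hA _ _ hc _ hx.2 _ hy.2 this

omit [DecidableEq R] in
/-- Counting the pulled-back pattern: `#T · |P| = (Σ_c #A_c) · |R|` when `lam` is surjective (all fibres have the size of the
kernel). [folklore] -/
theorem card_lamPattern_mul (lam : R →+ P) (hlam : Function.Surjective lam) (A : Fin 3 × Fin 3 → Finset P) :
    #(lamPattern lam A) * Fintype.card P = (∑ c, #(A c)) * Fintype.card R := by
  classical
  set K := #(univ.filter fun r : R => lam r = 0) with hK
  have hfib : ∀ z : P, #(univ.filter fun r : R => lam r = z) = K := fun z =>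
    AddMonoidHom.card_fiber_eq_of_mem_range lam (hlam z) ⟨0, map_zero lam⟩
  have hR : Fintype.card R = Fintype.card P * K := by
    rw [← card_univ, card_eq_sum_card_fiberwise (s := (univ : Finset R)) (t := (univ : Finset P)) (f := lam)
      (fun _ _ => mem_univ _)]
    simp only [hfib, sum_const, card_univ, smul_eq_mul]
  have hcol : ∀ c, #(univ.filter fun r : R => lam r ∈ A c) = #(A c) * K := by
    intro c
    rw [card_eq_sum_card_fiberwise (s := univ.filter fun r : R => lam r ∈ A c) (t := A c) (f := lam)
      (fun r hr => (mem_filter.1 hr).2)]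
    have : ∀ z ∈ A c, #((univ.filter fun r : R => lam r ∈ A c).filter fun r => lam r = z) = K := by
      intro z hz
      rw [← hfib z, filter_filter]
      congr 1
      ext r
      simp only [mem_filter, mem_univ, true_and, and_iff_right_iff_imp]
      intro h; rwa [h]
    rw [sum_congr rfl this, sum_const, smul_eq_mul]
  have hT : #(lamPattern lam A) = ∑ c, #(univ.filter fun r : R => lam r ∈ A c) := by
    rw [lamPattern, card_filter, ← univ_product_univ, sum_product]
    refine sum_congr rfl fun c _ => ?_
    rw [card_filter]
  rw [hT, hR]
  simp only [hcol, ← sum_mul]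
  ring

/-- **Pull-back form of the pattern lemma.**  Surjective `lam`, `lam ∘ dd = δ` off the diagonal, column sets avoiding `δ`, and
`9|P| ≤ 5 Σ_c #A_c` make `RCyc R q u` not box-useful (for a nondegenerate box). [folklore] -/
theorem not_boxUseful_of_lamPattern [NeZero q] [Fact (u ^ q = 1)] (hD : D.Nondeg u) (lam : R →+ P)
    (hlam : Function.Surjective lam) (A : Fin 3 × Fin 3 → Finset P) (δ : Fin 3 × Fin 3 → Fin 3 × Fin 3 → P)
    (hδ : ∀ c c', c ≠ c' → lam (D.dd u c c') = δ c c')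
    (hA : ∀ c c', c ≠ c' → ∀ z ∈ A c, ∀ z' ∈ A c', z - z' ≠ δ c c')
    (hbig : 9 * Fintype.card P ≤ 5 * ∑ c, #(A c)) : ¬ BoxUseful (RCyc R q u) := by
  refine D.not_boxUseful_of_pattern u hD (D.lamPattern_indep lam A δ hδ hA) ?_
  have hP : 0 < Fintype.card P := Fintype.card_pos
  have key := card_lamPattern_mul lam hlam A
  have : 9 * Fintype.card R * Fintype.card P ≤ 5 * #(lamPattern lam A) * Fintype.card P := by
    calc 9 * Fintype.card R * Fintype.card P = (9 * Fintype.card P) * Fintype.card R := by ring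
      _ ≤ (5 * ∑ c, #(A c)) * Fintype.card R := Nat.mul_le_mul_right _ hbig
      _ = 5 * (#(lamPattern lam A) * Fintype.card P) := by rw [key]; ring
      _ = 5 * #(lamPattern lam A) * Fintype.card P := by ring
  exact Nat.le_of_mul_le_mul_right this hP

end RCyc.RBox

/-! ### Residue intervals in `ZMod p` and the separation lemma -/

namespace TwoGen

/-- The residues whose representative in `[0, p)` lies in `[lo, hi]`. [folklore] -/
def Ival (p : ℕ) [NeZero p] (lo hi : ℕ) : Finset (ZMod p) := univ.filter fun z => lo ≤ z.val ∧ z.val ≤ hi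

/-- Membership in a residue interval. [folklore] -/
theorem mem_Ival {p : ℕ} [NeZero p] {lo hi : ℕ} {z : ZMod p} : z ∈ Ival p lo hi ↔ lo ≤ z.val ∧ z.val ≤ hi := by
  simp [Ival]

/-- A residue interval `[lo, hi]` with `hi < p` has `hi + 1 − lo` elements. [folklore] -/
theorem card_Ival {p : ℕ} [NeZero p] {lo hi : ℕ} (hhi : hi < p) : #(Ival p lo hi) = hi + 1 - lo := by
  have : Ival p lo hi = (Finset.Icc lo hi).image (fun k : ℕ => (k : ZMod p)) := by
    ext z
    simp only [mem_Ival, mem_image, mem_Icc]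
    constructor
    · rintro ⟨h1, h2⟩
      exact ⟨z.val, ⟨h1, h2⟩, ZMod.natCast_zmod_val z⟩
    · rintro ⟨k, ⟨h1, h2⟩, rfl⟩
      rw [ZMod.val_cast_of_lt (lt_of_le_of_lt h2 hhi)]
      exact ⟨h1, h2⟩
  rw [this, card_image_of_injOn, Nat.card_Icc]
  intro a ha b hb hab
  simp only [coe_Icc, Set.mem_Icc] at ha hb
  have := congrArg ZMod.val hab
  rwa [ZMod.val_cast_of_lt (lt_of_le_of_lt ha.2 hhi), ZMod.val_cast_of_lt (lt_of_le_of_lt hb.2 hhi)] at this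

/-- If `z − z' = e` in `ZMod p` with `|e| ≤ p`, then the representatives satisfy `z = z' + e`, `z = z' + e − p` or `z = z' + e + p`.
[folklore] -/
theorem val_cases_of_sub_eq {p : ℕ} [NeZero p] {z z' : ZMod p} {e : ℤ} (h : z - z' = (e : ZMod p))
    (he1 : -(p : ℤ) ≤ e) (he2 : e ≤ p) :
    (z.val : ℤ) = z'.val + e ∨ (z.val : ℤ) = z'.val + e - p ∨ (z.val : ℤ) = z'.val + e + p := by
  have hp : (0 : ℤ) < p := by exact_mod_cast Nat.pos_of_ne_zero (NeZero.ne p)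
  have hz : (z.val : ℤ) < p := by exact_mod_cast z.val_lt
  have hz' : (z'.val : ℤ) < p := by exact_mod_cast z'.val_lt
  have hE : ((((z.val : ℤ) - z'.val - e : ℤ)) : ZMod p) = 0 := by
    push_cast
    rw [ZMod.natCast_zmod_val, ZMod.natCast_zmod_val, ← h]
    ring
  obtain ⟨k, hk⟩ := (ZMod.intCast_zmod_eq_zero_iff_dvd _ p).1 hE
  have hk1 : k < 2 := by
    by_contra hc
    push Not at hc
    nlinarith
  have hk2 : -2 < k := by
    by_contra hc
    push Not at hc
    nlinarith
  have : k = -1 ∨ k = 0 ∨ k = 1 := by omega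
  rcases this with rfl | rfl | rfl <;> omega

end TwoGen

/-! ### The two-generator box and its coefficient law -/

namespace TwoGen

variable {R : Type*} [CommRing R]

/-- Coefficients `M = (0, 1, 2)` of `x` in `Y = {a^{M_i x}}`. [folklore] -/
def M (i : Fin 3) : ℤ := i.val

/-- Coefficients `N = (0, 3, 0)` of `x` in `W = {a^{N_j x} b^{(0,0,1)_j}}`. [folklore] -/
def N (j : Fin 3) : ℤ := if j.val = 1 then 3 else 0

/-- Indicator of the `b⁰`-columns: `B j = 1` for `j = 0, 1` and `B 2 = 0`. [folklore] -/
def B (j : Fin 3) : ℤ := if j.val = 2 then 0 else 1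

/-- The `b`-exponents `(0, 0, 1)` of `W`. [folklore] -/
def bexp (q : ℕ) (j : Fin 3) : ZMod q := if j.val = 2 then 1 else 0

/-- The two-generator box of `R ⋊_u ℤ/q`: `Y = {1, a^x, a^{2x}}`, `W = {1, a^{3x}, b}`. [folklore] -/
def box (q : ℕ) (x : R) : RCyc.RBox R q := ⟨fun i => (M i : R) * x, fun _ => 0, fun j => (N j : R) * x, bexp q⟩

/-- The coefficient law's integers: `hcoef (i,j) (i',j') = (M_{i'} − M_i − N_j)·B_{j'} + N_{j'}·B_j`. [folklore] -/
def hcoef (c c' : Fin 3 × Fin 3) : ℤ := (M c'.1 - M c.1 - N c.2) * B c'.2 + N c'.2 * B c.2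

/-- All coefficients lie in `[−5, 5]`. [folklore] -/
theorem hcoef_bound (c c' : Fin 3 × Fin 3) : -5 ≤ hcoef c c' ∧ hcoef c c' ≤ 5 := by
  revert c c'; decide

variable {q : ℕ} {u : R} {x : R} {P : Type*} [AddCommGroup P]

/-- `u^{b_j} = u` on the `b`-column and `1` on the two `b⁰`-columns (`1 < q`). [folklore] -/
theorem act_bexp [Fact (1 < q)] (j : Fin 3) : RCyc.act u (bexp q j) = if j.val = 2 then u else 1 := by
  unfold bexp RCyc.act
  split_ifs
  · rw [ZMod.val_one, pow_one]
  · rw [ZMod.val_zero, pow_zero]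

/-- `λ (u^{b_j} · (m x)) = (m · B_j) · λ x` when `λ (u x) = 0` (`1 < q`). [folklore] -/
theorem lam_act_mul [Fact (1 < q)] (lam : R →+ P) (hux : lam (u * x) = 0) (j : Fin 3) (m : ℤ) :
    lam (RCyc.act u (bexp q j) * ((m : R) * x)) = (m * B j) • lam x := by
  rw [act_bexp, B]
  split_ifs
  · rw [mul_left_comm, ← zsmul_eq_mul, map_zsmul, hux, smul_zero, mul_zero, zero_smul]
  · rw [one_mul, ← zsmul_eq_mul, map_zsmul, mul_one]

/-- **Coefficient law.** `λ (dd c c') = hcoef c c' · λ x` for the two-generator box, whenever `λ (u x) = 0`. [folklore] -/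
theorem lam_dd [Fact (u ^ q = 1)] [Fact (1 < q)] (lam : R →+ P) (hux : lam (u * x) = 0) (c c' : Fin 3 × Fin 3) :
    lam ((box q x).dd u c c') = hcoef c c' • lam x := by
  have e : (box q x).dd u c c' =
      RCyc.act u (bexp q c'.2) * (((M c'.1 - N c.2 : ℤ) : R) * x) + RCyc.act u (bexp q c.2) * (((N c'.2 : ℤ) : R) * x)
        - RCyc.act u (bexp q c'.2) * (((M c.1 : ℤ) : R) * x) := by
    simp only [RCyc.RBox.dd, box, zero_add, Int.cast_sub]
    ring
  rw [e, map_sub, map_add, lam_act_mul lam hux, lam_act_mul lam hux, lam_act_mul lam hux, hcoef, ← add_smul, ← sub_smul]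
  congr 1
  ring

/-- Nondegeneracy of the box from the injectivity of small coefficients: if `m x = m' x ⇒ m = m'` for `m, m' ∈ [0, 3]`, the
three `Y`-elements and the three `W`-elements are distinct. [folklore] -/
theorem box_nondeg [Fact (1 < q)] (hx : ∀ m m' : ℤ, 0 ≤ m → m ≤ 3 → 0 ≤ m' → m' ≤ 3 → (m : R) * x = (m' : R) * x → m = m') :
    (box q x).Nondeg u := by
  haveI : Nontrivial (ZMod q) := ZMod.nontrivial_iff.2 (Fact.out : 1 < q).ne'
  have hM : ∀ i : Fin 3, 0 ≤ M i ∧ M i ≤ 3 := fun i => by simp only [M]; omega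
  have hN : ∀ j : Fin 3, 0 ≤ N j ∧ N j ≤ 3 := fun j => by simp only [N]; split_ifs <;> omega
  refine (box q x).nondeg_of u ?_ ?_
  · intro i i' h
    simp only [box, Prod.mk.injEq] at h
    have := hx (M i) (M i') (hM i).1 (hM i).2 (hM i').1 (hM i').2 h.1
    simp only [M, Nat.cast_inj] at this
    exact Fin.ext this
  · intro j j' h
    simp only [box, Prod.mk.injEq, bexp] at h
    have := hx (N j) (N j') (hN j).1 (hN j).2 (hN j').1 (hN j').2 h.1
    have h2 := h.2
    fin_cases j <;> fin_cases j' <;> simp (decide := true) at this h2 ⊢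

end TwoGen

end Summit.MatrixMultiplication.OmegaCensus
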